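import Mathlib.RingTheory.AdjoinRoot
import Literature.Computability.Complexity.StackZnVectors
import HarnessLib

/-!
# Negacyclic products on stack registers: coefficient vectors as polynomials, the schoolbook multiplier

Literature / complexity toolkit, continuing `StackZnVectors.lean` (vectors of residues `encVec`,
the entrywise passes `vAddMod`, `vScaleMod`, the negacyclic shift `vNegShift`, and the generic
round / loop rules on the numeric layer `EReg ⊕ β`).  Second layer of the polynomial-arithmetic
programme serving the machine of Harvey's deterministic factoring algorithm
(`Cryptography/Harvey2021.lean`, fact `harvey_factoring_one_fifth` of `Cryptography/PQCWave0.lean`):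
the base case of the Schönhage–Strassen / Cantor–Kaltofen multiplier and, at the same time, the
algebraic semantics that all later layers use.

* `listPoly N v : (ZMod N)[X]` — the polynomial of a coefficient vector (constant term first);
  `coeff_listPoly`, `degree_listPoly_lt`, `listPoly_append`, and the meaning of the passes of
  `StackZnVectors.lean`: **`listPoly_vaddMod`** (addition), `listPoly_vsubMod`, `listPoly_vscaleMod`,
  `listPoly_map_negMod`, and **`mk_listPoly_negShift`** — in `AdjoinRoot (X^L + 1)` over `ZMod N`,
  `negShift N L e u` is `x^e · u` (`AdjoinRoot_mk_X_pow`: `x^L = -1`);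
* the schoolbook negacyclic product on vectors: `negMulStep` (`acc + x^i · (a · g)`),
  `negMulAcc`, **`negMul N L f g`**, with lengths / reducedness and the correctness theorem
  **`mk_listPoly_negMul`**: `listPoly (negMul N L f g) ≡ listPoly f · listPoly g (mod x^L + 1)`;
* the machine: roles `NReg` (the vector-pass roles `v x`, plus `FP`, `GP`, `ACC`), the record
  `NMSlots` / `nmSt` of the seven registers a round rewrites (so that symbolic states stay
  small), the round `negMulBody` (**`runs_negMulBody`**: read `f_i`, copy `g`, scale, shift by
  `x^i`, add into the accumulator, `E := i + 1`; cost `negMulBodyCost n L`, linear in `L`) and the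
  multiplier **`negacyclicMul`** (**`runs_negacyclicMul`**: `ACC := encVec (negMul N L f g)`, `FP`
  consumed, everything else restored, within `negMulCost n L` — quadratic in `L` times `(n+1)³`).

## References

* J. von zur Gathen, J. Gerhard, *Modern Computer Algebra*, 3rd ed., CUP 2013, §8.3 (the ring
  `R[x]/(x^n + 1)` and classical multiplication in it; the base case of Algorithm 8.20).
  (Not held; folklore material, fully proved here.)
* D. Harvey, *An exponent one-fifth algorithm for deterministic integer factorisation*, Math.
  Comp. 90 (2021), §2.2 (polynomials over `ℤ_N` as coefficient lists; `M_N(d)`) [Harvey2021].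
* T. Nipkow, G. Klein, *Concrete Semantics with Isabelle/HOL*, Springer 2014, §7.2 — the
  verification style of `StackPrograms.lean`.
-/

namespace Literature.Computability.Complexity

open _root_.Computability SProg Polynomial

/-! ### Coefficient vectors as polynomials over `ZMod N` -/

/-- The polynomial of a coefficient vector (constant term first) over `ZMod N`. [folklore] -/
noncomputable def listPoly (N : ℕ) : List ℕ → (ZMod N)[X]
  | [] => 0
  | a :: v => C (a : ZMod N) + X * listPoly N v

/-- `listPoly` of the empty vector. [folklore] -/
@[simp] theorem listPoly_nil (N : ℕ) : listPoly N [] = 0 := rfl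

/-- `listPoly` of a nonempty vector (Horner form). [folklore] -/
@[simp] theorem listPoly_cons (N a : ℕ) (v : List ℕ) : listPoly N (a :: v) = C (a : ZMod N) + X * listPoly N v := rfl

/-- `listPoly` of a concatenation. [folklore] -/
theorem listPoly_append (N : ℕ) (u v : List ℕ) :
    listPoly N (u ++ v) = listPoly N u + X ^ u.length * listPoly N v := by
  induction u with
  | nil => simp
  | cons a u ih => rw [List.cons_append, listPoly_cons, ih, listPoly_cons, List.length_cons, pow_succ]; ring

/-- **The coefficients of `listPoly v` are the entries of `v`** (zero beyond the end). [folklore] -/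
theorem coeff_listPoly (N : ℕ) (v : List ℕ) (i : ℕ) : (listPoly N v).coeff i = ((v.getD i 0 : ℕ) : ZMod N) := by
  induction v generalizing i with
  | nil => simp
  | cons a v ih =>
    rw [listPoly_cons, coeff_add, coeff_C]
    cases i with
    | zero => simp
    | succ i => rw [coeff_X_mul, ih]; simp

/-- The degree of `listPoly v` is below `|v|`. [folklore] -/
theorem degree_listPoly_lt (N : ℕ) (v : List ℕ) : (listPoly N v).degree < v.length := by
  rw [degree_lt_iff_coeff_zero]
  intro m hm
  rw [coeff_listPoly, List.getD_eq_default _ _ hm, Nat.cast_zero]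

/-- `listPoly` of a zero vector. [folklore] -/
theorem listPoly_replicate_zero (N L : ℕ) : listPoly N (List.replicate L 0) = 0 := by
  induction L with
  | zero => rfl
  | succ L ih => rw [List.replicate_succ, listPoly_cons, ih]; simp

/-- **Modular addition is addition of polynomials.** [folklore] -/
theorem listPoly_vaddMod (N : ℕ) {u v : List ℕ} (h : u.length = v.length) :
    listPoly N (vaddMod N u v) = listPoly N u + listPoly N v := by
  induction u generalizing v with
  | nil => cases v with
    | nil => simp
    | cons b v => simp at h
  | cons a u ih =>
    cases v with
    | nil => simp at h
    | cons b v =>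
      simp only [List.length_cons, Nat.add_right_cancel_iff] at h
      rw [vaddMod_cons, listPoly_cons, ih h, listPoly_cons, listPoly_cons, natCast_vaddMod_entry, C_add]
      ring

/-- **Modular subtraction is subtraction of polynomials** (subtrahend entries `≤ N`). [folklore] -/
theorem listPoly_vsubMod (N : ℕ) {u v : List ℕ} (h : u.length = v.length) (hv : ∀ b ∈ v, b ≤ N) :
    listPoly N (vsubMod N u v) = listPoly N u - listPoly N v := by
  induction u generalizing v with
  | nil => cases v with
    | nil => simp
    | cons b v => simp at h
  | cons a u ih =>
    cases v with
    | nil => simp at h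
    | cons b v =>
      simp only [List.length_cons, Nat.add_right_cancel_iff] at h
      rw [vsubMod_cons, listPoly_cons, ih h (fun x hx => hv x (by simp [hx])), listPoly_cons, listPoly_cons,
        natCast_vsubMod_entry N a (hv b (by simp)), C_sub]
      ring

/-- **Modular scaling is multiplication by a constant.** [folklore] -/
theorem listPoly_vscaleMod (N c : ℕ) (u : List ℕ) :
    listPoly N (vscaleMod N c u) = C (c : ZMod N) * listPoly N u := by
  induction u with
  | nil => simp
  | cons a u ih => rw [vscaleMod_cons, listPoly_cons, ih, listPoly_cons, natCast_vscaleMod_entry, C_mul]; ring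

/-- **Modular negation is negation** (entries `≤ N`). [folklore] -/
theorem listPoly_map_negMod (N : ℕ) {u : List ℕ} (hu : ∀ a ∈ u, a ≤ N) :
    listPoly N (u.map (negMod N)) = -listPoly N u := by
  induction u with
  | nil => simp
  | cons a u ih =>
    rw [List.map_cons, listPoly_cons, ih (fun x hx => hu x (by simp [hx])), listPoly_cons,
      natCast_negMod N (hu a (by simp)), C_neg]
    ring

/-! ### The negacyclic ring `(ℤ/N)[x]/(x^L + 1)` -/

/-- The modulus `x^L + 1`. [folklore] -/
noncomputable abbrev negMod_poly (N L : ℕ) : (ZMod N)[X] := X ^ L + 1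

/-- In `(ℤ/N)[x]/(x^L + 1)`, `x^L = -1`. [von zur Gathen–Gerhard 2013, §8.3] [folklore] -/
theorem AdjoinRoot_mk_X_pow (N L : ℕ) :
    AdjoinRoot.mk (negMod_poly N L) (X ^ L) = -1 := by
  have h : AdjoinRoot.mk (negMod_poly N L) (X ^ L + 1) = 0 := AdjoinRoot.mk_self
  rw [map_add, map_one] at h
  exact eq_neg_of_add_eq_zero_left h

/-- **The negacyclic shift is multiplication by `x^e`** in `(ℤ/N)[x]/(x^L + 1)`: for a block `u`
of length `L` with entries `≤ N` and `e < 2L`,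
`listPoly (negShift N L e u) ≡ x^e · listPoly u (mod x^L + 1)`. [von zur Gathen–Gerhard 2013,
§8.3] [folklore] -/
theorem mk_listPoly_negShift (N L e : ℕ) {u : List ℕ} (huL : u.length = L) (hu : ∀ a ∈ u, a ≤ N)
    (he : e < 2 * L) :
    AdjoinRoot.mk (negMod_poly N L) (listPoly N (negShift N L e u)) =
      AdjoinRoot.mk (negMod_poly N L) (X ^ e * listPoly N u) := by
  set φ := AdjoinRoot.mk (negMod_poly N L) with hφ
  have hXL : φ X ^ L = -1 := by rw [← map_pow]; exact AdjoinRoot_mk_X_pow N L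
  have hsplit : ∀ s, s ≤ L → φ (listPoly N u) =
      φ (listPoly N (u.take s)) + φ X ^ s * φ (listPoly N (u.drop s)) := by
    intro s hs
    conv_lhs => rw [← List.take_append_drop s u]
    rw [listPoly_append, map_add, map_mul, map_pow, List.length_take, huL, min_eq_left hs]
  unfold negShift
  split_ifs with h
  · -- `e < L`: split at `s = L - e`
    have hs := hsplit (L - e) (Nat.sub_le L e)
    have hpow : φ X ^ e * φ X ^ (L - e) = -1 := by rw [← pow_add, Nat.add_sub_cancel' h.le, hXL]
    rw [listPoly_append, map_add, map_mul, map_pow, List.length_map, List.length_drop, huL,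
      listPoly_map_negMod N (fun a ha => hu a (List.mem_of_mem_drop ha)), map_neg, map_mul, map_pow, hs,
      Nat.sub_sub_self h.le]
    linear_combination (-φ (listPoly N (u.drop (L - e)))) * hpow
  · -- `L ≤ e < 2L`: split at `s = 2L - e`; `x^e = x^L · x^(e-L) = -x^(e-L)`, `x^e · x^s = x^(2L) = 1`
    have h' : L ≤ e := Nat.not_lt.1 h
    have hs := hsplit (2 * L - e) (by omega)
    have h3 : φ X ^ e = -φ X ^ (e - L) := by
      conv_lhs => rw [show e = L + (e - L) by omega, pow_add, hXL]
      ring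
    have h4 : φ X ^ e * φ X ^ (2 * L - e) = 1 := by
      rw [← pow_add, show e + (2 * L - e) = L + L by omega, pow_add, hXL]; ring
    rw [listPoly_append, map_add, map_mul, map_pow, List.length_drop, huL,
      listPoly_map_negMod N (fun a ha => hu a (List.mem_of_mem_take ha)), map_neg, map_mul, map_pow, hs,
      show L - (2 * L - e) = e - L by omega]
    linear_combination (-φ (listPoly N (u.take (2 * L - e)))) * h3 + (-φ (listPoly N (u.drop (2 * L - e)))) * h4

/-! ### Specification of the schoolbook negacyclic product -/

/-- One accumulation step: `acc + x^i · (a · g)` on coefficient vectors. [folklore] -/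
def negMulStep (N L : ℕ) (g : List ℕ) (i a : ℕ) (acc : List ℕ) : List ℕ :=
  vaddMod N (negShift N L i (vscaleMod N a g)) acc

/-- Accumulating the entries of `f` from index `i`. [folklore] -/
def negMulAcc (N L : ℕ) (g : List ℕ) : List ℕ → ℕ → List ℕ → List ℕ
  | [], _, acc => acc
  | a :: f, i, acc => negMulAcc N L g f (i + 1) (negMulStep N L g i a acc)

/-- **The schoolbook negacyclic product** `f · g mod (x^L + 1)` on coefficient vectors:
`Σ_i f_i · (x^i · g)`, accumulated from the zero vector. [von zur Gathen–Gerhard 2013, §8.3]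
[folklore] -/
def negMul (N L : ℕ) (f g : List ℕ) : List ℕ := negMulAcc N L g f 0 (List.replicate L 0)

/-- `negMulAcc` of the empty list. [folklore] -/
@[simp] theorem negMulAcc_nil (N L : ℕ) (g : List ℕ) (i : ℕ) (acc : List ℕ) : negMulAcc N L g [] i acc = acc := rfl

/-- `negMulAcc` of a nonempty list. [folklore] -/
@[simp] theorem negMulAcc_cons (N L : ℕ) (g : List ℕ) (a : ℕ) (f : List ℕ) (i : ℕ) (acc : List ℕ) :
    negMulAcc N L g (a :: f) i acc = negMulAcc N L g f (i + 1) (negMulStep N L g i a acc) := rfl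

/-- `negMulAcc` processes a concatenation in order. [folklore] -/
theorem negMulAcc_append (N L : ℕ) (g f₁ f₂ : List ℕ) (i : ℕ) (acc : List ℕ) :
    negMulAcc N L g (f₁ ++ f₂) i acc = negMulAcc N L g f₂ (i + f₁.length) (negMulAcc N L g f₁ i acc) := by
  induction f₁ generalizing i acc with
  | nil => simp
  | cons a f₁ ih => rw [List.cons_append, negMulAcc_cons, ih, negMulAcc_cons, List.length_cons]; congr 1; omega

/-- A step preserves the length `L`. [folklore] -/
theorem length_negMulStep {N L : ℕ} {g : List ℕ} (hg : g.length = L) (i a : ℕ) {acc : List ℕ}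
    (hacc : acc.length = L) : (negMulStep N L g i a acc).length = L := by
  unfold negMulStep
  rw [length_vaddMod, length_negShift (by rw [length_vscaleMod, hg]), hacc, min_self]

/-- A step keeps the entries reduced. [folklore] -/
theorem lt_of_mem_negMulStep {N L : ℕ} (hN : 0 < N) (g : List ℕ) (i a : ℕ) (acc : List ℕ) {x : ℕ}
    (hx : x ∈ negMulStep N L g i a acc) : x < N :=
  lt_of_mem_vaddMod hN hx

/-- `negMulAcc` preserves the length `L`. [folklore] -/
theorem length_negMulAcc {N L : ℕ} {g : List ℕ} (hg : g.length = L) :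
    ∀ (f : List ℕ) (i : ℕ) {acc : List ℕ}, acc.length = L → (negMulAcc N L g f i acc).length = L
  | [], _, _, h => h
  | a :: f, i, _, h => length_negMulAcc hg f (i + 1) (length_negMulStep hg i a h)

/-- `negMulAcc` keeps the entries reduced. [folklore] -/
theorem lt_of_mem_negMulAcc {N L : ℕ} (hN : 0 < N) (g : List ℕ) :
    ∀ (f : List ℕ) (i : ℕ) (acc : List ℕ), (∀ x ∈ acc, x < N) → ∀ x ∈ negMulAcc N L g f i acc, x < N
  | [], _, _, h => h
  | a :: f, i, acc, _ => lt_of_mem_negMulAcc hN g f (i + 1) _ (fun _ hx => lt_of_mem_negMulStep hN g i a acc hx)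

/-- `negMul` has length `L`. [folklore] -/
theorem length_negMul {N L : ℕ} (f : List ℕ) {g : List ℕ} (hg : g.length = L) : (negMul N L f g).length = L :=
  length_negMulAcc hg f 0 (List.length_replicate)

/-- `negMul` has reduced entries. [folklore] -/
theorem lt_of_mem_negMul {N L : ℕ} (hN : 0 < N) (f g : List ℕ) {x : ℕ} (hx : x ∈ negMul N L f g) : x < N :=
  lt_of_mem_negMulAcc hN g f 0 _ (fun y hy => by rw [List.eq_of_mem_replicate hy]; exact hN) x hx

/-- **Correctness of one accumulation step** in `(ℤ/N)[x]/(x^L + 1)`. [folklore] -/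
theorem mk_listPoly_negMulStep (N L : ℕ) {g : List ℕ} (hg : g.length = L) (hgN : ∀ b ∈ g, b < N)
    {i : ℕ} (hi : i < 2 * L) (a : ℕ) {acc : List ℕ} (hacc : acc.length = L) :
    AdjoinRoot.mk (negMod_poly N L) (listPoly N (negMulStep N L g i a acc)) =
      AdjoinRoot.mk (negMod_poly N L) (listPoly N acc) +
        AdjoinRoot.mk (negMod_poly N L) X ^ i * AdjoinRoot.mk (negMod_poly N L) (C (a : ZMod N)) *
          AdjoinRoot.mk (negMod_poly N L) (listPoly N g) := by
  have hN : ∀ b ∈ vscaleMod N a g, b ≤ N := fun b hb =>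
    (lt_of_mem_vscaleMod (by rcases g with _ | ⟨c, g⟩ <;> [simp at hb; exact (by have := hgN c (by simp); omega)]) hb).le
  unfold negMulStep
  rw [listPoly_vaddMod N (by rw [length_negShift (by rw [length_vscaleMod, hg]), hacc]), map_add,
    mk_listPoly_negShift N L i (by rw [length_vscaleMod, hg]) hN hi, listPoly_vscaleMod, map_mul, map_mul, map_pow]
  ring

/-- **Correctness of the accumulation**: `negMulAcc g f i acc ≡ acc + x^i · f · g (mod x^L + 1)`.
[folklore] -/
theorem mk_listPoly_negMulAcc (N L : ℕ) {g : List ℕ} (hg : g.length = L) (hgN : ∀ b ∈ g, b < N) :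
    ∀ (f : List ℕ) (i : ℕ) {acc : List ℕ}, acc.length = L → i + f.length ≤ 2 * L →
      AdjoinRoot.mk (negMod_poly N L) (listPoly N (negMulAcc N L g f i acc)) =
        AdjoinRoot.mk (negMod_poly N L) (listPoly N acc) +
          AdjoinRoot.mk (negMod_poly N L) X ^ i * AdjoinRoot.mk (negMod_poly N L) (listPoly N f) *
            AdjoinRoot.mk (negMod_poly N L) (listPoly N g)
  | [], i, acc, _, _ => by simp
  | a :: f, i, acc, hacc, hif => by
    rw [negMulAcc_cons, mk_listPoly_negMulAcc N L hg hgN f (i + 1) (length_negMulStep hg i a hacc)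
      (by simp at hif; omega), mk_listPoly_negMulStep N L hg hgN (by simp at hif; omega) a hacc, listPoly_cons,
      map_add, map_mul, AdjoinRoot.mk_X, pow_succ]
    ring

/-- **The schoolbook negacyclic product is the product** in `(ℤ/N)[x]/(x^L + 1)`:
`listPoly (negMul N L f g) ≡ listPoly f · listPoly g (mod x^L + 1)` for `|g| = L`, `|f| ≤ 2L`.
[von zur Gathen–Gerhard 2013, §8.3] [folklore] -/
theorem mk_listPoly_negMul (N L : ℕ) {f g : List ℕ} (hf : f.length ≤ 2 * L) (hg : g.length = L)
    (hgN : ∀ b ∈ g, b < N) :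
    AdjoinRoot.mk (negMod_poly N L) (listPoly N (negMul N L f g)) =
      AdjoinRoot.mk (negMod_poly N L) (listPoly N f) * AdjoinRoot.mk (negMod_poly N L) (listPoly N g) := by
  unfold negMul
  rw [mk_listPoly_negMulAcc N L hg hgN f 0 List.length_replicate (by simpa using hf), listPoly_replicate_zero]
  simp

/-! ### Register roles of the schoolbook multiplier -/

/-- Roles of the schoolbook multiplier: the vector-pass roles `v x`, the consumed factor `FP`,
the preserved factor `GP`, the accumulator `ACC`. [folklore] -/
inductive NReg where
  | v (x : VReg)
  | FP | GP | ACC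
  deriving DecidableEq

/-- The vector-pass roles inside the multiplier's roles. [folklore] -/
def NReg.ιV : VReg ↪ NReg := ⟨NReg.v, fun _ _ h => NReg.v.inj h⟩

/-- `ιV` is the constructor `v`. [folklore] -/
@[simp] theorem NReg.ιV_apply (x : VReg) : NReg.ιV x = NReg.v x := rfl

namespace Com

variable {β : Type} [DecidableEq β] (q : NReg ↪ β)

/-- The vector-pass roles in the outer bank. [folklore] -/
abbrev rV : VReg ↪ β := NReg.ιV.trans q

/-- The body of the schoolbook loop: with the next coefficient `a = f_i` of `FP`, the block `g` in
`GP`, the accumulator in `ACC` and `i` in `E`: `ACC := ACC + x^i · (a · g)`, `E := i + 1`.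
[von zur Gathen–Gerhard 2013, §8.3 (classical multiplication in `R[x]/(x^n+1)`)] [folklore] -/
def negMulBody : Com (EReg ⊕ β) :=
  readItemTo (Sum.inr (q .FP)) (vr (rV q) .C) (vr (rV q) .W) (vr (rV q) .TT) ;;
  (copy (Sum.inr (q .GP)) (vr (rV q) .L1) (ra .t) (ra .u) ;;
  (vScaleMod (rV q) ;;
  (move (vr (rV q) .DST) (vr (rV q) .L1) (ra .s) ;;
  (vNegShift (rV q) ;;
  (move (vr (rV q) .DST) (vr (rV q) .L1) (ra .s) ;;
  (move (Sum.inr (q .ACC)) (vr (rV q) .L2) (ra .s) ;;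
  (vAddMod (rV q) ;;
  (move (vr (rV q) .DST) (Sum.inr (q .ACC)) (ra .s) ;;
  (clear (vr (rV q) .C) ;;
  (NS.op (.succ (rV q .E) (rV q .E))).com)))))))))

/-- Cost of one round of the schoolbook loop on blocks of length `L`. [folklore] -/
def negMulBodyCost (n L : ℕ) : ℕ := L * (2600 * (n + 1) ^ 3) + 360 * (n + 1) ^ 3

/-- The clean-scratch condition of the multiplier: modulus and block length in place, all the
vector-pass scratch roles and `DST`, `L1`, `L2` empty. [folklore] -/
def NegMulInv (N L : ℕ) (T : Regs β) : Prop :=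
  T (q (.v .MD)) = encodeNat N ∧ T (q (.v .LEN)) = encodeNat L ∧ T (q (.v .A)) = [] ∧ T (q (.v .B)) = [] ∧
    T (q (.v .C)) = [] ∧ T (q (.v .D)) = [] ∧ T (q (.v .F)) = [] ∧ T (q (.v .G)) = [] ∧ T (q (.v .W)) = [] ∧
    T (q (.v .TT)) = [] ∧ T (q (.v .O)) = [] ∧ T (q (.v .S)) = [] ∧ T (q (.v .U)) = [] ∧
    T (q (.v .L1)) = [] ∧ T (q (.v .L2)) = [] ∧ T (q (.v .DST)) = []

/-- Length of the code of a vector of reduced entries. [folklore] -/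
theorem length_encVec_le_of_lt {v : List ℕ} {N n : ℕ} (hv : ∀ a ∈ v, a < N) (hn : (encodeNat N).length + 1 ≤ n) :
    (encVec v).length ≤ v.length * (2 * n) :=
  (length_encVec_le (m := n - 1) fun a ha => (length_encodeNat_le_of_lt_nat (hv a ha)).trans (by omega)).trans
    (Nat.mul_le_mul_left _ (by omega))

/-! ### The working registers of a round as a record -/

/-- Contents of the seven registers a round of the schoolbook loop rewrites. [folklore] -/
structure NMSlots where
  /-- remaining coefficients of `f` -/ (fp : List Bool)
  /-- the current coefficient -/ (cc : List Bool)
  /-- vector-pass input 1 -/ (l1 : List Bool)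
  /-- vector-pass destination -/ (dst : List Bool)
  /-- vector-pass input 2 -/ (l2 : List Bool)
  /-- the accumulator -/ (acc : List Bool)
  /-- the exponent counter -/ (e : List Bool)

/-- The register file with the seven working registers set from a record. [folklore] -/
def nmSt (T : Regs β) (z : NMSlots) : Regs β :=
  Function.update (Function.update (Function.update (Function.update (Function.update (Function.update
    (Function.update T (q .FP) z.fp) (q (.v .C)) z.cc) (q (.v .L1)) z.l1) (q (.v .DST)) z.dst) (q (.v .L2)) z.l2)
    (q .ACC) z.acc) (q (.v .E)) z.e

section NmStLemmas

variable (T : Regs β) (z : NMSlots) (w : List Bool)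

/-- Reading `FP`. [folklore] -/
@[simp] theorem nmSt_FP : nmSt q T z (q .FP) = z.fp := by simp [nmSt]
/-- Reading `C`. [folklore] -/
@[simp] theorem nmSt_C : nmSt q T z (q (.v .C)) = z.cc := by simp [nmSt]
/-- Reading `L1`. [folklore] -/
@[simp] theorem nmSt_L1 : nmSt q T z (q (.v .L1)) = z.l1 := by simp [nmSt]
/-- Reading `DST`. [folklore] -/
@[simp] theorem nmSt_DST : nmSt q T z (q (.v .DST)) = z.dst := by simp [nmSt]
/-- Reading `L2`. [folklore] -/
@[simp] theorem nmSt_L2 : nmSt q T z (q (.v .L2)) = z.l2 := by simp [nmSt]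
/-- Reading `ACC`. [folklore] -/
@[simp] theorem nmSt_ACC : nmSt q T z (q .ACC) = z.acc := by simp [nmSt]
/-- Reading `E`. [folklore] -/
@[simp] theorem nmSt_E : nmSt q T z (q (.v .E)) = z.e := by simp [nmSt]
/-- Reading `GP` (untouched). [folklore] -/
@[simp] theorem nmSt_GP : nmSt q T z (q .GP) = T (q .GP) := by simp [nmSt]
/-- Reading an untouched vector-pass role. [folklore] -/
theorem nmSt_v {x : VReg} (h1 : x ≠ .C) (h2 : x ≠ .L1) (h3 : x ≠ .DST) (h4 : x ≠ .L2) (h5 : x ≠ .E) :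
    nmSt q T z (q (.v x)) = T (q (.v x)) := by simp [nmSt, h1, h2, h3, h4, h5]

/-- Writing `FP`. [folklore] -/
@[simp] theorem update_nmSt_FP : Function.update (nmSt q T z) (q .FP) w = nmSt q T { z with fp := w } := by
  refine Regs.eq_of_on [q .FP] (by simp) fun k hk => ?_
  simp only [List.mem_singleton] at hk
  simp only [nmSt, Function.update_apply, hk, if_false]
/-- Writing `C`. [folklore] -/
@[simp] theorem update_nmSt_C : Function.update (nmSt q T z) (q (.v .C)) w = nmSt q T { z with cc := w } := by
  refine Regs.eq_of_on [q (.v .C)] (by simp) fun k hk => ?_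
  simp only [List.mem_singleton] at hk
  simp only [nmSt, Function.update_apply, hk, if_false]
/-- Writing `L1`. [folklore] -/
@[simp] theorem update_nmSt_L1 : Function.update (nmSt q T z) (q (.v .L1)) w = nmSt q T { z with l1 := w } := by
  refine Regs.eq_of_on [q (.v .L1)] (by simp) fun k hk => ?_
  simp only [List.mem_singleton] at hk
  simp only [nmSt, Function.update_apply, hk, if_false]
/-- Writing `DST`. [folklore] -/
@[simp] theorem update_nmSt_DST : Function.update (nmSt q T z) (q (.v .DST)) w = nmSt q T { z with dst := w } := by
  refine Regs.eq_of_on [q (.v .DST)] (by simp) fun k hk => ?_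
  simp only [List.mem_singleton] at hk
  simp only [nmSt, Function.update_apply, hk, if_false]
/-- Writing `L2`. [folklore] -/
@[simp] theorem update_nmSt_L2 : Function.update (nmSt q T z) (q (.v .L2)) w = nmSt q T { z with l2 := w } := by
  refine Regs.eq_of_on [q (.v .L2)] (by simp) fun k hk => ?_
  simp only [List.mem_singleton] at hk
  simp only [nmSt, Function.update_apply, hk, if_false]
/-- Writing `ACC`. [folklore] -/
@[simp] theorem update_nmSt_ACC : Function.update (nmSt q T z) (q .ACC) w = nmSt q T { z with acc := w } := by
  refine Regs.eq_of_on [q .ACC] (by simp) fun k hk => ?_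
  simp only [List.mem_singleton] at hk
  simp only [nmSt, Function.update_apply, hk, if_false]
/-- Writing `E`. [folklore] -/
@[simp] theorem update_nmSt_E : Function.update (nmSt q T z) (q (.v .E)) w = nmSt q T { z with e := w } := by
  refine Regs.eq_of_on [q (.v .E)] (by simp) fun k hk => ?_
  simp only [List.mem_singleton] at hk
  simp only [nmSt, Function.update_apply, hk, if_false]

end NmStLemmas

/-- **One round of the schoolbook loop.** [von zur Gathen–Gerhard 2013, §8.3] [folklore] -/
theorem runs_negMulBody {N n L i a : ℕ} {f g acc : List ℕ} (hn : (encodeNat N).length + 1 ≤ n)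
    (hLn : (encodeNat L).length + 1 ≤ n) (T : Regs β) (hI : NegMulInv q N L T)
    (hGP : T (q .GP) = encVec g) (ha : a < N) (hg : ∀ b ∈ g, b < N) (hgL : g.length = L)
    (hacc : ∀ b ∈ acc, b < N) (haccL : acc.length = L) (hi : i < L) :
    Runs (negMulBody q) (base (nmSt q T ⟨encVec (a :: f), [], [], [], [], encVec acc, encodeNat i⟩))
      (base (nmSt q T ⟨encVec f, [], [], [], [], encVec (negMulStep N L g i a acc), encodeNat (i + 1)⟩))
      (negMulBodyCost n L) := by
  have hq : ∀ {i j : NReg}, i ≠ j → q i ≠ q j := fun h => q.injective.ne h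
  obtain ⟨hMD, hLEN, hA, hB, -, hD, hF, hG, hW, hTT, hO, hS, hU, -, -, -⟩ := hI
  -- reads of the untouched registers through any record
  have rMD : ∀ z, nmSt q T z (q (.v .MD)) = encodeNat N := fun z => by rw [nmSt_v q T z] <;> first | decide | exact hMD
  have rLEN : ∀ z, nmSt q T z (q (.v .LEN)) = encodeNat L := fun z => by rw [nmSt_v q T z] <;> first | decide | exact hLEN
  have rA : ∀ z, nmSt q T z (q (.v .A)) = [] := fun z => by rw [nmSt_v q T z] <;> first | decide | exact hA
  have rB : ∀ z, nmSt q T z (q (.v .B)) = [] := fun z => by rw [nmSt_v q T z] <;> first | decide | exact hB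
  have rD : ∀ z, nmSt q T z (q (.v .D)) = [] := fun z => by rw [nmSt_v q T z] <;> first | decide | exact hD
  have rF : ∀ z, nmSt q T z (q (.v .F)) = [] := fun z => by rw [nmSt_v q T z] <;> first | decide | exact hF
  have rG : ∀ z, nmSt q T z (q (.v .G)) = [] := fun z => by rw [nmSt_v q T z] <;> first | decide | exact hG
  have rW : ∀ z, nmSt q T z (q (.v .W)) = [] := fun z => by rw [nmSt_v q T z] <;> first | decide | exact hW
  have rTT : ∀ z, nmSt q T z (q (.v .TT)) = [] := fun z => by rw [nmSt_v q T z] <;> first | decide | exact hTT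
  have rO : ∀ z, nmSt q T z (q (.v .O)) = [] := fun z => by rw [nmSt_v q T z] <;> first | decide | exact hO
  have rS : ∀ z, nmSt q T z (q (.v .S)) = [] := fun z => by rw [nmSt_v q T z] <;> first | decide | exact hS
  have rU : ∀ z, nmSt q T z (q (.v .U)) = [] := fun z => by rw [nmSt_v q T z] <;> first | decide | exact hU
  have hN : 0 < N := by omega
  set c := (n + 1) ^ 3 with hc3
  have hc : n + 1 ≤ c := succ_le_cube n
  have hla : (encodeNat a).length ≤ n - 1 := (length_encodeNat_le_of_lt_nat ha).trans (by omega)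
  have hli : (encodeNat i).length ≤ n - 1 := (Brick.length_encodeNat_mono hi.le).trans (by omega)
  -- the intermediate vectors
  set sc := vscaleMod N a g with hsc
  set sh := negShift N L i sc with hsh
  set res := vaddMod N sh acc with hres
  have hscN : ∀ b ∈ sc, b < N := fun b hb => lt_of_mem_vscaleMod hN hb
  have hscL : sc.length = L := by rw [hsc, length_vscaleMod, hgL]
  have hshN : ∀ b ∈ sh, b < N := fun b hb => lt_of_mem_negShift hN hscN hb
  have hshL : sh.length = L := length_negShift hscL
  have hresN : ∀ b ∈ res, b < N := fun b hb => lt_of_mem_vaddMod hN hb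
  have hres' : res = negMulStep N L g i a acc := rfl
  have hlg : (encVec g).length ≤ L * (2 * n) := (length_encVec_le_of_lt hg hn).trans (by rw [hgL])
  have hlsc : (encVec sc).length ≤ L * (2 * n) := (length_encVec_le_of_lt hscN hn).trans (by rw [hscL])
  have hlsh : (encVec sh).length ≤ L * (2 * n) := (length_encVec_le_of_lt hshN hn).trans (by rw [hshL])
  have hlacc : (encVec acc).length ≤ L * (2 * n) := (length_encVec_le_of_lt hacc hn).trans (by rw [haccL])
  have hlres : (encVec res).length ≤ L * (2 * n) :=
    (length_encVec_le_of_lt hresN hn).trans (by rw [hres', length_negMulStep hgL i a haccL])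
  have hLn2 : L * (2 * n) ≤ 2 * (L * c) :=
    calc L * (2 * n) = 2 * (L * n) := by ring
      _ ≤ 2 * (L * c) := Nat.mul_le_mul_left 2 (Nat.mul_le_mul_left L (by omega))
  -- the records along the round
  let z0 : NMSlots := ⟨encVec (a :: f), [], [], [], [], encVec acc, encodeNat i⟩
  let z1 : NMSlots := ⟨encVec f, encodeNat a, [], [], [], encVec acc, encodeNat i⟩
  let z2 : NMSlots := ⟨encVec f, encodeNat a, encVec g, [], [], encVec acc, encodeNat i⟩
  let z3 : NMSlots := ⟨encVec f, encodeNat a, [], encVec sc, [], encVec acc, encodeNat i⟩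
  let z4 : NMSlots := ⟨encVec f, encodeNat a, encVec sc, [], [], encVec acc, encodeNat i⟩
  let z5 : NMSlots := ⟨encVec f, encodeNat a, [], encVec sh, [], encVec acc, encodeNat i⟩
  let z6 : NMSlots := ⟨encVec f, encodeNat a, encVec sh, [], [], encVec acc, encodeNat i⟩
  let z7 : NMSlots := ⟨encVec f, encodeNat a, encVec sh, [], encVec acc, [], encodeNat i⟩
  let z8 : NMSlots := ⟨encVec f, encodeNat a, [], encVec res, [], [], encodeNat i⟩
  let z9 : NMSlots := ⟨encVec f, encodeNat a, [], [], [], encVec res, encodeNat i⟩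
  let z10 : NMSlots := ⟨encVec f, [], [], [], [], encVec res, encodeNat i⟩
  let z11 : NMSlots := ⟨encVec f, [], [], [], [], encVec res, encodeNat (i + 1)⟩
  -- 1. read the coefficient
  have h1 : Runs (readItemTo (Sum.inr (q .FP)) (vr (rV q) .C) (vr (rV q) .W) (vr (rV q) .TT)) (base (nmSt q T z0))
      (base (nmSt q T z1)) (11 * c) := by
    refine (runs_readItemTo (by simp [hq]) (by simp [hq]) (by simp [hq]) (by simp [hq]) (by simp [hq]) (encodeNat a) (encVec f)
      (base (nmSt q T z0)) (by simp [z0, encVec_cons]) (by simp [rW]) (by simp [rTT])).of_eq (by simp [z0, z1]) ?_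
    omega
  -- 2. copy the block
  have h2 : Runs (copy (Sum.inr (q .GP)) (vr (rV q) .L1) (ra .t) (ra .u)) (base (nmSt q T z1)) (base (nmSt q T z2))
      (20 * (L * c) + 3 * c) := by
    refine (runs_ocopy (a := q .GP) (b := rV q .L1) (by simp [hq]) (nmSt q T z1)).of_eq (by simp [z1, z2, hGP]) ?_
    rw [nmSt_GP, hGP]; omega
  -- 3. scale
  have h3 : Runs (vScaleMod (rV q)) (base (nmSt q T z2)) (base (nmSt q T z3)) (vArithCost n L) := by
    have h := runs_vScaleMod (rV q) hn ha (nmSt q T z2) (u := g) hg (by simp [z2]) (by simp [rMD]) (by simp [z2])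
      (by simp [rA]) (by simp [rB]) (by simp [rD]) (by simp [rF]) (by simp [rW]) (by simp [rTT]) (by simp [rO])
    rw [hgL] at h
    exact h.of_eq (by simp [z2, z3, hsc]) le_rfl
  -- 4. move to L1
  have h4 : Runs (move (vr (rV q) .DST) (vr (rV q) .L1) (ra .s)) (base (nmSt q T z3)) (base (nmSt q T z4))
      (12 * (L * c) + 2 * c) := by
    refine (runs_omove (a := rV q .DST) (b := rV q .L1) (by simp [hq]) (nmSt q T z3)).of_eq (by simp [z3, z4]) ?_
    have : (nmSt q T z3 (rV q .DST)).length ≤ L * (2 * n) := by simp [z3, hlsc]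
    omega
  -- 5. shift
  have h5 : Runs (vNegShift (rV q)) (base (nmSt q T z4)) (base (nmSt q T z5)) (vShiftCost n L) := by
    have h := runs_vNegShift (rV q) hn hLn (show i < 2 * L by omega) (nmSt q T z4) (u := sc) hscN hscL (by simp [z4])
      (by simp [rMD]) (by simp [z4]) (by simp [rLEN]) (by simp [rA]) (by simp [rB]) (by simp [rD]) (by simp [rF])
      (by simp [rG]) (by simp [rW]) (by simp [rTT]) (by simp [rO]) (by simp [rS]) (by simp [rU])
    exact h.of_eq (by simp [z4, z5, hsh]) le_rfl
  -- 6. move to L1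
  have h6 : Runs (move (vr (rV q) .DST) (vr (rV q) .L1) (ra .s)) (base (nmSt q T z5)) (base (nmSt q T z6))
      (12 * (L * c) + 2 * c) := by
    refine (runs_omove (a := rV q .DST) (b := rV q .L1) (by simp [hq]) (nmSt q T z5)).of_eq (by simp [z5, z6]) ?_
    have : (nmSt q T z5 (rV q .DST)).length ≤ L * (2 * n) := by simp [z5, hlsh]
    omega
  -- 7. move the accumulator to L2
  have h7 : Runs (move (Sum.inr (q .ACC)) (vr (rV q) .L2) (ra .s)) (base (nmSt q T z6)) (base (nmSt q T z7))
      (12 * (L * c) + 2 * c) := by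
    refine (runs_omove (a := q .ACC) (b := rV q .L2) (by simp [hq]) (nmSt q T z6)).of_eq (by simp [z6, z7]) ?_
    have : (nmSt q T z6 (q .ACC)).length ≤ L * (2 * n) := by simp [z6, hlacc]
    omega
  -- 8. add
  have h8 : Runs (vAddMod (rV q)) (base (nmSt q T z7)) (base (nmSt q T z8)) (vArithCost n L) := by
    have h := runs_vAddMod (rV q) hn (nmSt q T z7) (u := sh) (v := acc) (by rw [hshL, haccL]) hshN hacc
      (by simp [z7]) (by simp [z7]) (by simp [rMD]) (by simp [rA]) (by simp [rB]) (by simp [rD]) (by simp [rF])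
      (by simp [rW]) (by simp [rTT]) (by simp [rO])
    rw [hshL] at h
    exact h.of_eq (by simp [z7, z8, hres]) le_rfl
  -- 9. move the result to ACC
  have h9 : Runs (move (vr (rV q) .DST) (Sum.inr (q .ACC)) (ra .s)) (base (nmSt q T z8)) (base (nmSt q T z9))
      (12 * (L * c) + 2 * c) := by
    refine (runs_omove (a := rV q .DST) (b := q .ACC) (by simp [hq]) (nmSt q T z8)).of_eq (by simp [z8, z9]) ?_
    have : (nmSt q T z8 (rV q .DST)).length ≤ L * (2 * n) := by simp [z8, hlres]
    omega
  -- 10. clear the coefficient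
  have h10 : Runs (clear (vr (rV q) .C)) (base (nmSt q T z9)) (base (nmSt q T z10)) (3 * c) := by
    refine (runs_clear (vr (rV q) .C) (base (nmSt q T z9))).of_eq (by simp [z9, z10]) ?_
    change 2 * (nmSt q T z9 (rV q .C)).length + 1 ≤ 3 * c
    have : (nmSt q T z9 (rV q .C)).length ≤ n - 1 := by simp [z9, hla]
    omega
  -- 11. increment the exponent
  have h11 : Runs (NS.op (.succ (rV q .E) (rV q .E)) : NS β).com (base (nmSt q T z10)) (base (nmSt q T z11)) (72 * c) :=
    NS.runs_of_eq (N := n) _ _ (by simp only [NS.ok, NOp.ok, Function.Embedding.trans_apply, NReg.ιV_apply, nmSt_E, z10]; omega)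
      (by simp [z10, z11]) (by simp [hc3])
  refine (h1.seq (h2.seq (h3.seq (h4.seq (h5.seq (h6.seq (h7.seq (h8.seq (h9.seq (h10.seq h11)))))))))).of_eq rfl ?_
  have : negMulBodyCost n L = 2600 * (L * c) + 360 * c := by unfold negMulBodyCost; rw [← hc3]; ring
  rw [this]
  have hA : vArithCost n L = 1050 * (L * c) + 5 := by unfold vArithCost; rw [← hc3]; ring
  have hS : vShiftCost n L = 400 * (L * c) + 250 * c := by unfold vShiftCost; rw [← hc3]; ring
  rw [hA, hS]
  omega

/-- **The schoolbook negacyclic multiplier.** With `f` in `FP` (consumed), `g` in `GP`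
(preserved), `L` in `LEN` and the modulus in `MD`: `ACC := encVec (negMul N L f g)` — build the
zero block, run the accumulation loop over the coefficients of `f`, reset the exponent counter.
[von zur Gathen–Gerhard 2013, §8.3 (classical multiplication in `R[x]/(x^n+1)`)] [folklore] -/
def negacyclicMul : Com (EReg ⊕ β) :=
  nToUnary (rV q .U) (rV q .LEN) ;;
  (countLoop (vr (rV q) .U) (push (Sum.inr (q .ACC)) true ;; push (Sum.inr (q .ACC)) false) ;;
  (streamLoop (Sum.inr (q .FP)) (vr (rV q) .W) (negMulBody q) ;;
  clear (vr (rV q) .E)))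

/-- Cost of the schoolbook multiplier on blocks of length `L` at size bound `n`: quadratic in `L`.
[folklore] -/
def negMulCost (n L : ℕ) : ℕ := L * L * (2600 * (n + 1) ^ 3) + L * (400 * (n + 1) ^ 3) + 40 * (n + 1) ^ 3

/-- Coding of a zero block, one entry more. [folklore] -/
theorem encVec_replicate_zero_succ (k : ℕ) :
    encVec (List.replicate (k + 1) 0) = false :: true :: encVec (List.replicate k 0) := by
  rw [List.replicate_succ, encVec_cons]; rfl

/-- **The schoolbook negacyclic multiplier computes `negMul`.** From a file satisfying the
clean-scratch condition with `FP = encVec f` (`|f| ≤ L`, entries `< N`), `GP = encVec g`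
(`|g| = L`, entries `< N`), `ACC` and `E` empty, `negacyclicMul` ends with `FP` empty and
`ACC = encVec (negMul N L f g)`, everything else as before, within `negMulCost n L` steps; and
`negMul N L f g` is the product `f · g` in `(ℤ/N)[x]/(x^L+1)` (`mk_listPoly_negMul`).
[von zur Gathen–Gerhard 2013, §8.3] [folklore] -/
theorem runs_negacyclicMul {N n L : ℕ} {f g : List ℕ} (hn : (encodeNat N).length + 1 ≤ n)
    (hLn : (encodeNat L).length + 1 ≤ n) (T : Regs β) (hI : NegMulInv q N L T)
    (hFP : T (q .FP) = encVec f) (hGP : T (q .GP) = encVec g) (hACC : T (q .ACC) = [])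
    (hE : T (q (.v .E)) = []) (hf : ∀ a ∈ f, a < N) (hfL : f.length ≤ L) (hg : ∀ b ∈ g, b < N)
    (hgL : g.length = L) :
    Runs (negacyclicMul q) (base T)
      (base (Function.update (Function.update T (q .FP) []) (q .ACC) (encVec (negMul N L f g)))) (negMulCost n L) := by
  have hq : ∀ {i j : NReg}, i ≠ j → q i ≠ q j := fun h => q.injective.ne h
  have hI' := hI
  obtain ⟨hMD, hLEN, hA, hB, hC, hD, hF, hG, hW, hTT, hO, hS, hU, hL1, hL2, hDST⟩ := hI'
  set c := (n + 1) ^ 3 with hc3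
  have hc : n + 1 ≤ c := succ_le_cube n
  have hLc : L * (n + 1) ≤ L * c := Nat.mul_le_mul_left _ hc
  set zeros := List.replicate L 0 with hzeros
  -- 1. the unary counter
  set T1 := Function.update T (q (.v .U)) (List.replicate L true) with hT1
  have h1 : Runs (nToUnary (rV q .U) (rV q .LEN)) (base T) (base T1) (16 * (L * c) + 26 * c) := by
    refine (runs_nToUnary (rV q .U) (rV q .LEN) T (by simpa using hU)).of_eq (by simp [hT1, hLEN]) ?_
    simp only [Function.Embedding.trans_apply, NReg.ιV_apply, hLEN, bitsToNat_encodeNat]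
    have h3 : (encodeNat L).length * (16 * L + 21) ≤ (n - 1) * (16 * L + 21) := Nat.mul_le_mul_right _ (by omega)
    have h4 : (n - 1) * (16 * L + 21) ≤ 16 * (L * (n + 1)) + 21 * (n + 1) := by nlinarith [Nat.sub_le n 1]
    omega
  -- 2. the zero block
  let st : ℕ → Regs β := fun k => Function.update (Function.update T (q (.v .U)) (List.replicate k true)) (q .ACC)
    (encVec (List.replicate (L - k) 0))
  set T2 := st 0 with hT2
  have h2 : Runs (countLoop (vr (rV q) .U) (push (Sum.inr (q .ACC)) true ;; push (Sum.inr (q .ACC)) false))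
      (base T1) (base T2) (L * (2 + 2) + 1) := by
    have h := runs_countLoop (U := vr (rV q) .U) (body := push (Sum.inr (q .ACC)) true ;; push (Sum.inr (q .ACC)) false)
      (fun k R => k ≤ L ∧ R = base (st k)) 2
      (by
        rintro k R ⟨hk, rfl⟩ -
        refine ⟨base (st k), ?_, by simp [st, hq], by omega, rfl⟩
        have e1 : Function.update (base (st (k + 1))) (vr (rV q) .U) (List.replicate k true) =
            base (Function.update (st (k + 1)) (q (.v .U)) (List.replicate k true)) := by simp
        rw [e1]
        refine ((Runs.opush (q .ACC) true _).seq (Runs.opush (q .ACC) false _)).of_eq ?_ le_rfl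
        congr 1
        refine Regs.eq_of_on [q .ACC, q (.v .U)] ?_ ?_
        · intro x hx
          simp only [List.mem_cons, List.not_mem_nil, or_false] at hx
          have hz : encVec (List.replicate (L - k) 0) = false :: true :: encVec (List.replicate (L - (k + 1)) 0) := by
            rw [show L - k = (L - (k + 1)) + 1 by omega, encVec_replicate_zero_succ]
          rcases hx with rfl | rfl
          · simp [st, hq, hz]
          · simp [st, hq]
        · intro x hx
          simp only [List.mem_cons, List.not_mem_nil, or_false, not_or] at hx
          obtain ⟨h₁, h₂⟩ := hx
          simp [st, h₁, h₂])
      L (base T1) ⟨le_rfl, by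
        rw [hT1]; congr 1
        exact (Function.update_eq_self_iff.2 (by simp [hq, hACC])).symm⟩ (by simp [hT1])
    obtain ⟨R', hR, -, -, rfl⟩ := h
    exact hR
  -- the file after initialisation, as a record
  have hTU : Function.update T (q (.v .U)) [] = T := Function.update_eq_self_iff.2 hU.symm
  have hT2' : T2 = Function.update T (q .ACC) (encVec zeros) := by
    simp only [hT2, st, List.replicate_zero, Nat.sub_zero, hzeros, hTU]
  let zOf : List ℕ → List ℕ → NMSlots := fun done l =>
    ⟨encVec l, [], [], [], [], encVec (negMulAcc N L g done 0 zeros), encodeNat done.length⟩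
  have hnm : ∀ done l, nmSt q T (zOf done l) = Function.update (Function.update (Function.update T (q .FP) (encVec l))
      (q .ACC) (encVec (negMulAcc N L g done 0 zeros))) (q (.v .E)) (encodeNat done.length) := by
    intro done l
    refine Regs.eq_of_on [q .FP, q (.v .C), q (.v .L1), q (.v .DST), q (.v .L2), q .ACC, q (.v .E)] ?_ ?_
    · intro x hx
      simp only [List.mem_cons, List.not_mem_nil, or_false] at hx
      rcases hx with rfl | rfl | rfl | rfl | rfl | rfl | rfl <;> simp [zOf, hq, hC, hL1, hDST, hL2]
    · intro x hx
      simp only [List.mem_cons, List.not_mem_nil, or_false, not_or] at hx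
      obtain ⟨h₁, h₂, h₃, h₄, h₅, h₆, h₇⟩ := hx
      simp [nmSt, h₁, h₂, h₃, h₄, h₅, h₆, h₇]
  have hTF : Function.update T (q .FP) (encVec f) = T := Function.update_eq_self_iff.2 hFP.symm
  have hstart : base T2 = base (nmSt q T (zOf [] f)) := by
    rw [hT2', hnm]
    congr 1
    simp only [negMulAcc_nil, List.length_nil, hTF]
    exact (Function.update_eq_self_iff.2 (by rw [Function.update_of_ne (hq (by decide))]; exact hE.symm)).symm
  -- 3. the accumulation loop
  have hzN : ∀ x ∈ zeros, x < N := by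
    intro x hx
    rw [hzeros] at hx
    have hL : 0 < L := by have := List.length_pos_of_mem hx; simpa using this
    obtain ⟨b, hb⟩ := List.exists_mem_of_length_pos (l := g) (by omega)
    have := hg b hb
    rw [List.eq_of_mem_replicate hx]; omega
  have hloop := runs_streamLoop (L := Sum.inr (q .FP)) (w := vr (rV q) .W) (by simp [hq]) (body := negMulBody q)
    encVec rfl (fun a l => encVec_cons_ne_nil _ _)
    (fun l R => ∃ done, done ++ l = f ∧ R = base (nmSt q T (zOf done l))) (fun _ => negMulBodyCost n L)
    (by
      rintro a l R ⟨done, hdl, rfl⟩ - -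
      have hal : a ∈ f := by rw [← hdl]; simp
      have hN : 0 < N := by have := hf a hal; omega
      have hlen : done.length < L := by
        have := congrArg List.length hdl; simp at this; omega
      have hb := runs_negMulBody q hn hLn T hI hGP (hf a hal) hg hgL
        (acc := negMulAcc N L g done 0 zeros) (f := l) (i := done.length)
        (lt_of_mem_negMulAcc hN g done 0 zeros hzN) (length_negMulAcc hgL done 0 (by simp [hzeros])) hlen
      refine ⟨_, hb.of_eq ?_ le_rfl, by simp [zOf], ?_, done ++ [a], by simp [hdl], rfl⟩
      · simp only [zOf, negMulAcc_append, negMulAcc_cons, negMulAcc_nil, List.length_append, List.length_singleton,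
          Nat.zero_add]
      · exact (nmSt_v q T _ (by decide) (by decide) (by decide) (by decide) (by decide)).trans hW)
    f (base (nmSt q T (zOf [] f))) ⟨[], rfl, rfl⟩ (by simp [zOf])
      ((nmSt_v q T _ (by decide) (by decide) (by decide) (by decide) (by decide)).trans hW)
  obtain ⟨R', h3, -, -, done, hdone, rfl⟩ := hloop
  rw [List.append_nil] at hdone
  subst hdone
  rw [← hstart] at h3
  -- 4. reset the exponent counter
  have h4 : Runs (clear (vr (rV q) .E)) (base (nmSt q T (zOf done [])))
      (base (Function.update (nmSt q T (zOf done [])) (q (.v .E)) [])) (3 * c) := by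
    refine (runs_clear (vr (rV q) .E) (base (nmSt q T (zOf done [])))).of_eq (by simp) ?_
    change 2 * (nmSt q T (zOf done []) (rV q .E)).length + 1 ≤ 3 * c
    have : (nmSt q T (zOf done []) (rV q .E)).length ≤ n - 1 := by
      simp only [Function.Embedding.trans_apply, NReg.ιV_apply, nmSt_E, zOf]
      exact (Brick.length_encodeNat_mono hfL).trans (by omega)
    omega
  refine (h1.seq (h2.seq (h3.seq h4))).of_eq ?_ ?_
  · congr 1
    refine Regs.eq_of_on [q .FP, q (.v .C), q (.v .L1), q (.v .DST), q (.v .L2), q .ACC, q (.v .E)] ?_ ?_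
    · intro x hx
      simp only [List.mem_cons, List.not_mem_nil, or_false] at hx
      rcases hx with rfl | rfl | rfl | rfl | rfl | rfl | rfl <;> simp [nmSt, zOf, hq, hC, hL1, hDST, hL2, hE, negMul, hzeros]
    · intro x hx
      simp only [List.mem_cons, List.not_mem_nil, or_false, not_or] at hx
      obtain ⟨h₁, h₂, h₃, h₄, h₅, h₆, h₇⟩ := hx
      simp [nmSt, h₁, h₂, h₃, h₄, h₅, h₆, h₇]
  · simp only [List.map_const', List.sum_replicate, smul_eq_mul]
    have hbody : negMulBodyCost n L = 2600 * (L * c) + 360 * c := by unfold negMulBodyCost; rw [← hc3]; ring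
    have htot : negMulCost n L = 2600 * (L * (L * c)) + 400 * (L * c) + 40 * c := by unfold negMulCost; rw [← hc3]; ring
    rw [hbody, htot]
    have hf1 : done.length * (2600 * (L * c) + 360 * c + 6) ≤ L * (2600 * (L * c) + 360 * c + 6) :=
      Nat.mul_le_mul_right _ hfL
    have hL6 : L * 6 ≤ 6 * (L * c) := by nlinarith
    nlinarith [hf1, hL6, hLc, hc]

end Com

end Literature.Computability.Complexity
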